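import Summits.FinalStateConjecture.FinalStateConjecture.Theorems.SwallowTheDatumParametricKerrBurialCollarLine
import Summits.FinalStateConjecture.FinalStateConjecture.Theorems.SwallowTheDatumParametricKerrBurialStubBreathing
import Summits.FinalStateConjecture.FinalStateConjecture.Theorems.SwallowTheDatumParametricKerrBurialStubCollarDilationB

/-!
# Line `null-shell-shadow-collar` — skeleton v2 for crux `SwallowTheDatum.ParametricKerrBurial`
(crux item stmt-FinalStateConjecture-10052; second line lead prover-line-stmt-FinalStateConjecture-10052-b-0,
2026-08-16; reshape of the planner's skeleton `Lines/null-shell-shadow-collar.lean`, card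
`Lines/null-shell-shadow-collar.md`).

RESHAPE v2 (lead): (i) the line now runs over the FIRST line's landed vocabulary
(`Theorems/SwallowTheDatumParametricKerrBurialLine.lean`: `SmoothSectionsOn`, `AgreeAt`,
`IsExactSchwarzschildBeyond`, `IsSchwarzschildAnnulus`, `IsKerrShielded`, `IsKerrShieldedAway`, `junction`), so
that the d-side stub `stub_farGluing` and the injectivity stub `stub_breathing` are REGISTERED WITH THE SAME
SIGNATURES as the first line's (shared: one landing serves both lines), and the planner's `stub_eventualConstancy`
+ `stub_transfer` are replaced by the first line's finer transfer chain (dilation / transport-patch / breathing /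
the PROVED junction lemma); (ii) the whole ENGINE is moved to ZERO SPIN: the shadow collar is required Klein-four
symmetric (rotations by `π` about the three axes — a symmetric short-pulse seed exists), the interior gluing is
Li–Mei Prop 4.1 run EQUIVARIANTLY (only `∂_t` of the cokernel is invariant, absorbed by the mass: output
Schwarzschild(`m`)-cylinder data, `a = 0`), and the capping is pure Schwarzschild, where the tree has closed forms
(`KerrDataSchwarzschild*`, `stub_isotropicEnd`, `stub_sliceClause`, `bentHeight*`); (iii) the collar predicate
`IsCollar l μ C` asks vacuum only OUTSIDE the ball of radius `l` and an exactly isotropic-Schwarzschild far end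
(so completeness / sole end / DR decay of every transported datum come from tree lemmas), which makes
`stub_collarDilation` / `stub_transportPatch` the weaker-hypothesis versions of the first line's.

The vocabulary (`VacuumOn`, `IsIsotropicBeyond`, `IsCollar`, `schwCylMap`, `NearSchwarzschildCylinder`,
`IsSchwarzschildCylinderOn`, `axisFlip`, `IsKleinSymmetricOn`) and the two sorry-free compositions `universalCollar_of`,
`ParametricKerrBurial_of_collarLine` are IMPORTED from the landed support file
`Theorems/SwallowTheDatumParametricKerrBurialCollarLine.lean`; this file holds only the seven registered stubs
(explicit signatures, exactly as registered on the item with `ledger workitem stub-add`) and the skeleton theorem.  Stubs: `stub_farGluing` (shared, XL; OPEN — named-fact debt), `stub_shadowCollar`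
(hardest, XL, lead; OPEN), `stub_interiorGluing` (XL, printed + equivariance rider; OPEN), `stub_capping` (L–XL, explicit;
OPEN, taken by route prover seat-1), `stub_collarDilationB` (CLOSED p92772), `stub_transportPatchB` (L; OPEN, worker),
`stub_breathing` (shared; CLOSED p86339).
`ParametricKerrBurial_of : ParametricKerrBurial := ParametricKerrBurial_of_collarLine stub_farGluing
(universalCollar_of stub_shadowCollar stub_interiorGluing stub_capping) stub_collarDilationB stub_transportPatchB
stub_breathing` concludes the crux BY NAME.

DISPROOF USED (`Cruxes/ParametricKerrBurial/Disproof.lean` v6, no kill): `_false_without_admissible` — admissibility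
of `d` enters at `stub_farGluing` and `F 0 = d`; `_false_without_ne_zero` / §5–§8 teeth (every shield forces
`k ≢ 0` on its unbent zone, any spin) — respected: the collar's time-symmetric annulus `{l<‖y‖<2l}` is disjoint from
the shield range (`IsKerrShieldedAway (2l)`), the cap's unbent zone is a Kerr–Schild slice piece; §7/§9
swell-or-recede — the shields recede (`R(c) → ∞`); `bentHeight_scale`, `rPlus_scale` — used by
`stub_collarDilationB`.
-/

set_option linter.dupNamespace false

noncomputable section

namespace Summit.FinalStateConjecture.FinalStateConjecture.Cruxes.ParametricKerrBurial.NullShellShadowCollar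

open scoped Manifold ContDiff Topology
open Bundle Set Filter Function Literature.Geometry.Lorentzian
open Summit.FinalStateConjecture.FinalStateConjecture.Theorems.SwallowTheDatum.ParametricKerrBurial

/-! ## Registered stubs (signatures exactly as on the item) -/

/-- STUB (d-side, size XL, SHARED with line `receding-annulus-universal-collar`): Mao–Oh–Tao receding far-annulus
gluing onto a growing exact isotropic Schwarzschild seed, smooth in the radius. -/
theorem stub_farGluing :
    ∀ (X : Type) [TopologicalSpace X] [ChartedSpace E3 X] [IsManifold (𝓡 3) ∞ X] [T2Space X]
      [SecondCountableTopology X] [ConnectedSpace X], ∀ d ∈ admissibleVacuumData X,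
      ∃ (η : ℝ) (e : AFEnd X) (Rstar : ℝ) (m : ℝ → ℝ) (G : ℝ → InitialDataSet (𝓡 3) X),
        0 < η ∧ e.IsSoleEnd ∧ e.R < Rstar ∧ ContDiff ℝ ∞ m ∧
        SmoothSectionsOn 𝓘(ℝ, ℝ) G {p : ℝ × X | Rstar < p.1} ∧
        ∀ R : ℝ, Rstar < R → G R ∈ admissibleVacuumData X ∧ (∀ x ∉ e.far R, AgreeAt (G R) d x) ∧
          η * R ≤ m R ∧ IsExactSchwarzschildBeyond e (G R) (m R) (32 * R) := by
  sorry

/-- STUB (THE LEVER, hardest, size XL, held by the lead): the Klein-symmetric Schwarzschild(`μ`)-seeded shadow collar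
(Luk–Rodnianski `δ → 0` limit + Birkhoff). -/
theorem stub_shadowCollar :
    ∀ [Kerr.Facts], ∀ μ : ℝ, 0 < μ → μ ≤ 1 →
      ∃ (M r₁ r₀ ρ₁ ρ₂ : ℝ), 0 < r₁ ∧ r₁ < r₀ ∧ r₀ < 2 * M ∧ 2 ≤ ρ₁ ∧ ρ₁ < ρ₂ ∧
        ∀ (k : ℕ) (ε : ℝ), 0 < ε →
          ∃ D : InitialDataSet (𝓡 3) E3,
            VacuumOn {y | 1 < ‖y‖ ∧ ‖y‖ < ρ₂} D ∧ IsSchwarzschildAnnulus D μ ∧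
            IsKleinSymmetricOn ρ₂ D ∧ NearSchwarzschildCylinder M r₁ r₀ ρ₁ ρ₂ k ε D := by
  sorry

/-- STUB (size XL, printed + equivariance rider): Li–Mei Prop 4.1 run under the Klein four-group, output the exact
Schwarzschild(`m`) cylinder. -/
theorem stub_interiorGluing :
    ∀ [Kerr.Facts], ∀ (M r₁ r₀ ρ₁ ρ₂ : ℝ), 0 < r₁ → r₁ < r₀ → r₀ < 2 * M → 2 ≤ ρ₁ → ρ₁ < ρ₂ →
      ∃ (k : ℕ) (ε : ℝ), 0 < ε ∧
        ∀ D : InitialDataSet (𝓡 3) E3,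
          VacuumOn {y | 1 < ‖y‖ ∧ ‖y‖ < ρ₂} D → IsKleinSymmetricOn ρ₂ D →
          NearSchwarzschildCylinder M r₁ r₀ ρ₁ ρ₂ k ε D →
          ∃ (D' : InitialDataSet (𝓡 3) E3) (m τ₀ ρ' : ℝ),
            (∀ y : E3, ‖y‖ < ρ₁ → D'.h.inner y = D.h.inner y ∧ D'.k y = D.k y) ∧
            VacuumOn {y | 1 < ‖y‖ ∧ ‖y‖ < ρ₂} D' ∧
            0 < r₀ ∧ r₀ < 2 * m ∧ ρ₁ < ρ' ∧ ρ' < ρ₂ ∧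
            IsSchwarzschildCylinderOn m r₀ τ₀ {y | ρ' < ‖y‖ ∧ ‖y‖ < ρ₂} D' := by
  sorry

/-- STUB (size L–XL, explicit zero-spin geometry): cap exact Schwarzschild-cylinder data into a collar-type datum
(vacuum outside the unit ball, isotropic end, shield beyond `ρ'`). -/
theorem stub_capping :
    ∀ [Kerr.Facts], ∀ (D' : InitialDataSet (𝓡 3) E3) (m r₀ τ₀ ρ' ρ₂ : ℝ),
      1 ≤ ρ' → ρ' < ρ₂ → 0 < r₀ → r₀ < 2 * m →
      VacuumOn {y | 1 < ‖y‖ ∧ ‖y‖ < ρ₂} D' →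
      IsSchwarzschildCylinderOn m r₀ τ₀ {y | ρ' < ‖y‖ ∧ ‖y‖ < ρ₂} D' →
      ∃ C : InitialDataSet (𝓡 3) E3,
        (∀ y : E3, ‖y‖ ≤ ρ' → C.h.inner y = D'.h.inner y ∧ C.k y = D'.k y) ∧
        VacuumOn {y | 1 < ‖y‖} C ∧
        (∃ Mend Rend : ℝ, 0 ≤ Mend ∧ 0 < Rend ∧ IsIsotropicBeyond Mend Rend C) ∧
        IsKerrShieldedAway ρ' C := by
  sorry

/-- CLOSED STUB (was size L, plumbing on `E3`): dilation covariance of `IsCollar` — LANDED as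
`Theorems.SwallowTheDatum.ParametricKerrBurial.stub_collarDilationB` (p92772, b-0 worker, 2026-08-16T09:38Z). -/
theorem stub_collarDilationB :
    ∀ [Kerr.Facts] (C : InitialDataSet (𝓡 3) E3) (μ : ℝ), 0 < μ → IsCollar 1 μ C →
      ∃ Cfam : ℝ → InitialDataSet (𝓡 3) E3,
        SmoothSectionsOn 𝓘(ℝ, ℝ) Cfam {p : ℝ × E3 | 0 < p.1} ∧ ∀ l : ℝ, 0 < l → IsCollar l μ (Cfam l) :=
  Summit.FinalStateConjecture.FinalStateConjecture.Theorems.SwallowTheDatum.ParametricKerrBurial.stub_collarDilationB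

/-- STUB (size L, plumbing on `X`): transport the collar family by the chart of the end and patch it to the
far-glued family. -/
theorem stub_transportPatchB :
    ∀ [Kerr.Facts] (X : Type) [TopologicalSpace X] [ChartedSpace E3 X] [IsManifold (𝓡 3) ∞ X]
      [T2Space X] [SecondCountableTopology X] [ConnectedSpace X] (e : AFEnd X) (Rstar η μ : ℝ)
      (m : ℝ → ℝ) (G : ℝ → InitialDataSet (𝓡 3) X) (Cfam : ℝ → InitialDataSet (𝓡 3) E3),
      e.IsSoleEnd → e.R < Rstar → 0 < μ → 32 * μ ≤ η → ContDiff ℝ ∞ m →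
      SmoothSectionsOn 𝓘(ℝ, ℝ) G {p : ℝ × X | Rstar < p.1} →
      (∀ R : ℝ, Rstar < R → G R ∈ admissibleVacuumData X ∧ η * R ≤ m R ∧
        IsExactSchwarzschildBeyond e (G R) (m R) (32 * R)) →
      SmoothSectionsOn 𝓘(ℝ, ℝ) Cfam {p : ℝ × E3 | 0 < p.1} →
      (∀ l : ℝ, 0 < l → IsCollar l μ (Cfam l)) →
      ∃ P : ℝ → InitialDataSet (𝓡 3) X, SmoothSectionsOn 𝓘(ℝ, ℝ) P {p : ℝ × X | Rstar < p.1} ∧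
        ∀ R : ℝ, Rstar < R → P R ∈ admissibleVacuumData X ∧ IsKerrShielded X (P R) ∧
          ∀ x ∉ e.far (32 * R), AgreeAt (P R) (G R) x := by
  sorry

/-- CLOSED STUB (SHARED with line `receding-annulus-universal-collar`): the breathing / injectivity device — LANDED as
`Theorems.SwallowTheDatum.ParametricKerrBurial.stub_breathing` (p86339, route prover seat-1, 2026-08-16T08:20Z). -/
theorem stub_breathing :
    ∀ [Kerr.Facts] (X : Type) [TopologicalSpace X] [ChartedSpace E3 X] [IsManifold (𝓡 3) ∞ X]
      [T2Space X] [SecondCountableTopology X] [ConnectedSpace X] (d : InitialDataSet (𝓡 3) X)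
      (e : AFEnd X) (Rstar : ℝ) (P : ℝ → InitialDataSet (𝓡 3) X), e.R < Rstar →
      SmoothSectionsOn 𝓘(ℝ, ℝ) P {p : ℝ × X | Rstar < p.1} →
      (∀ R : ℝ, Rstar < R → P R ∈ admissibleVacuumData X ∧ IsKerrShielded X (P R) ∧
        ∀ x ∉ e.far R, AgreeAt (P R) d x) →
      ∃ (S : ℝ × ℝ → InitialDataSet (𝓡 3) X) (E : ℝ → InitialDataSet (𝓡 3) X) (x₀ : X)
        (v₀ : TangentSpace (𝓡 3) x₀),
        SmoothSectionsOn (𝓘(ℝ, ℝ).prod 𝓘(ℝ, ℝ)) S {p : (ℝ × ℝ) × X | Rstar < p.1.1} ∧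
        SmoothSectionsOn 𝓘(ℝ, ℝ) E (Set.univ : Set (ℝ × X)) ∧ E 0 = d ∧
        (∀ R t : ℝ, Rstar < R → ∀ x ∉ e.far R, AgreeAt (S (R, t)) (E t) x) ∧ x₀ ∉ e.far Rstar ∧
        Set.InjOn (fun t : ℝ ↦ (E t).h.inner x₀ v₀ v₀) (Set.Ioo (-1) 1) ∧
        ∀ R t : ℝ, Rstar < R → |t| < 1 → S (R, t) ∈ admissibleVacuumData X ∧ IsKerrShielded X (S (R, t)) :=
  Summit.FinalStateConjecture.FinalStateConjecture.Theorems.SwallowTheDatum.ParametricKerrBurial.stub_breathing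

/-! ## Kernel-checked composition -/

/-- **THE SKELETON THEOREM** (audited by name): the crux `SwallowTheDatum.ParametricKerrBurial` BY NAME from the seven
registered stubs, through the landed compositions `universalCollar_of` and `ParametricKerrBurial_of_collarLine`.
Sorry-free itself (sorries live only inside `stub_*`). -/
theorem ParametricKerrBurial_of :
    Summit.FinalStateConjecture.FinalStateConjecture.Theses.SwallowTheDatum.ParametricKerrBurial :=
  ParametricKerrBurial_of_collarLine stub_farGluing
    (universalCollar_of stub_shadowCollar stub_interiorGluing stub_capping)
    stub_collarDilationB stub_transportPatchB stub_breathing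

end Summit.FinalStateConjecture.FinalStateConjecture.Cruxes.ParametricKerrBurial.NullShellShadowCollar

end
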